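import Literature.Probability.Percolation.ArmEventsAPriori
import Literature.Probability.Percolation.TriAnnulusCircuit
import HarnessLib

/-!
# Hexagonally convex regions of `𝕋` are connected

Topic `Literature/Probability/Percolation`; family `crit-perc`. Lattice geometry for the boundary
layer of the pivotal analysis of Werner's Lemma 6.3 (`LandedAltPivotalCut.lean` and its sequel;
W. Werner, PCMI 2009, Lecture 6, proof of Lemma 6.2, "the contributions due to those `x`'s that are
close to the edges … do not matter much"). One auxiliary DEFINITION (a family of sets of sites), no
named fact.

A **hexagonally convex region** of the triangular lattice `𝕋 = ℤ²` (coordinates `x₀, x₁`, third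
axis `x₀ + x₁`) is a set cut out by upper bounds on the six linear forms
`±x₀, ±x₁, ±(x₀ + x₁)`: `hexConvex c = {z | z₀ ≤ c₀, -z₀ ≤ c₁, z₁ ≤ c₂, -z₁ ≤ c₃, z₀ + z₁ ≤ c₄,
-(z₀ + z₁) ≤ c₅}` (`c : Fin 6 → ℤ`). Hexagons `Λ_D(v)`, half-planes beyond a side of `Λ_N`, the
cones over the sides, and their intersections are of this form. The point of this file:

* `exists_step_toward` — for `u ≠ 0` there is a lattice step `e` (one of the six neighbours of
  `0`) with `|u - e|_𝕋 = |u|_𝕋 - 1` which does not increase any of the six linear forms beyond its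
  value at `u`: `ℓ(e) ≤ 0` or `1 ≤ ℓ(u)` for each form `ℓ` (case analysis over the six closed
  sectors, as `exists_adj_triNorm_eq_sub_one`);
* **`pathIn_hexConvex`** — any two sites of `hexConvex c` are joined by a `𝕋`-path inside it: step
  from `a` towards `b` with `exists_step_toward (b - a)`; the new site satisfies every constraint
  because `ℓ(a + e) ≤ max(ℓ(a), ℓ(b))`; induction on `|b - a|_𝕋`;
* `pathIn_of_hexConvex_subset` — the same inside any set containing such a region (the form used
  downstream: exhibit six constants for which both sites and the region fit).

## References

* W. Werner, *Lectures on two-dimensional critical percolation*, IAS/Park City Math. Ser. 16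
  (2009), Lecture 6, proof of Lemma 6.2 (boundary contributions) [WernerPCMI2009].
* P. Nolin, Near-critical percolation in two dimensions, *Electron. J. Probab.* 13 (2008), §4.6,
  §6.2 [Nolin2008].

Tree: `triNorm_le_iff_lin`, `le_triNorm_iff_lin` (`ArmEventsAPriori.lean`), `triGraph_adj_iff_coord`
(`TriAnnulusCircuit.lean`), `PathIn` (`SitePaths.lean`), `triNorm_zero`.
-/

noncomputable section

open Set

namespace Literature.Probability.Percolation

open LatticeModels

/-! ### Hexagonally convex regions -/

/-- **A hexagonally convex region of `𝕋`**: upper bounds `c 0, …, c 5` on the six linear forms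
`x₀, -x₀, x₁, -x₁, x₀ + x₁, -(x₀ + x₁)`. [folklore] -/
def hexConvex (c : Fin 6 → ℤ) : Set (Site 2) :=
  {z | z 0 ≤ c 0 ∧ -z 0 ≤ c 1 ∧ z 1 ≤ c 2 ∧ -z 1 ≤ c 3 ∧ z 0 + z 1 ≤ c 4 ∧ -(z 0 + z 1) ≤ c 5}

/-- Membership in `hexConvex c`, unfolded. [folklore] -/
@[simp] theorem mem_hexConvex {c : Fin 6 → ℤ} {z : Site 2} :
    z ∈ hexConvex c ↔
      z 0 ≤ c 0 ∧ -z 0 ≤ c 1 ∧ z 1 ≤ c 2 ∧ -z 1 ≤ c 3 ∧ z 0 + z 1 ≤ c 4 ∧ -(z 0 + z 1) ≤ c 5 :=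
  Iff.rfl

/-! ### A step towards a target that respects the six forms -/

/-- **A step towards `u ≠ 0` respecting the six linear forms**: there are `a, b` with `(a, b)` one
of the six lattice steps, `|u - (a, b)|_𝕋 = |u|_𝕋 - 1`, and for each of the six forms `ℓ`,
`ℓ(a, b) ≤ 0` or `1 ≤ ℓ(u)`. [folklore] -/
theorem exists_step_toward {u : Site 2} (hu : u ≠ 0) :
    ∃ a b : ℤ, ((a = 1 ∧ b = 0) ∨ (a = -1 ∧ b = 0) ∨ (a = 0 ∧ b = 1) ∨ (a = 0 ∧ b = -1) ∨
        (a = 1 ∧ b = -1) ∨ (a = -1 ∧ b = 1)) ∧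
      triNorm (![u 0 - a, u 1 - b] : Site 2) = triNorm u - 1 ∧
      (a ≤ 0 ∨ 1 ≤ u 0) ∧ (-a ≤ 0 ∨ 1 ≤ -u 0) ∧ (b ≤ 0 ∨ 1 ≤ u 1) ∧ (-b ≤ 0 ∨ 1 ≤ -u 1) ∧
      (a + b ≤ 0 ∨ 1 ≤ u 0 + u 1) ∧ (-(a + b) ≤ 0 ∨ 1 ≤ -(u 0 + u 1)) := by
  set n := triNorm u with hn
  obtain ⟨h1, h2, h3, h4, h5, h6⟩ := triNorm_le_iff_lin.1 (le_refl n)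
  have hge := le_triNorm_iff_lin.1 (le_refl n)
  have hn1 : 1 ≤ n := by
    by_contra hlt
    push Not at hlt
    apply hu
    ext i; fin_cases i <;> simp <;> omega
  -- the norm of the new difference from the six linear bounds
  have normeq : ∀ a b : ℤ,
      (u 0 - a ≤ n - 1 ∧ -(u 0 - a) ≤ n - 1 ∧ u 1 - b ≤ n - 1 ∧ -(u 1 - b) ≤ n - 1 ∧
        u 0 - a + (u 1 - b) ≤ n - 1 ∧ -(u 0 - a + (u 1 - b)) ≤ n - 1) →
      (n - 1 ≤ u 0 - a ∨ n - 1 ≤ -(u 0 - a) ∨ n - 1 ≤ u 1 - b ∨ n - 1 ≤ -(u 1 - b) ∨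
        n - 1 ≤ u 0 - a + (u 1 - b) ∨ n - 1 ≤ -(u 0 - a + (u 1 - b))) →
      triNorm (![u 0 - a, u 1 - b] : Site 2) = n - 1 := by
    intro a b hle hge'
    apply le_antisymm
    · rw [triNorm_le_iff_lin]
      simpa only [Matrix.cons_val_zero, Matrix.cons_val_one] using hle
    · rw [le_triNorm_iff_lin]
      simpa only [Matrix.cons_val_zero, Matrix.cons_val_one] using hge'
  rcases hge with h | h | h | h | h | h
  · -- `n = u₀`: step `(1, 0)`, or `(1, -1)` on the corner ray `u₁ = -n`
    by_cases hc : -n < u 1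
    · exact ⟨1, 0, by omega, normeq 1 0 (by omega) (by omega), by omega, by omega, by omega,
        by omega, by omega, by omega⟩
    · exact ⟨1, -1, by omega, normeq 1 (-1) (by omega) (by omega), by omega, by omega, by omega,
        by omega, by omega, by omega⟩
  · -- `n = -u₀`
    by_cases hc : u 1 < n
    · exact ⟨-1, 0, by omega, normeq (-1) 0 (by omega) (by omega), by omega, by omega, by omega,
        by omega, by omega, by omega⟩
    · exact ⟨-1, 1, by omega, normeq (-1) 1 (by omega) (by omega), by omega, by omega, by omega,
        by omega, by omega, by omega⟩
  · -- `n = u₁`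
    by_cases hc : -n < u 0
    · exact ⟨0, 1, by omega, normeq 0 1 (by omega) (by omega), by omega, by omega, by omega,
        by omega, by omega, by omega⟩
    · exact ⟨-1, 1, by omega, normeq (-1) 1 (by omega) (by omega), by omega, by omega, by omega,
        by omega, by omega, by omega⟩
  · -- `n = -u₁`
    by_cases hc : u 0 < n
    · exact ⟨0, -1, by omega, normeq 0 (-1) (by omega) (by omega), by omega, by omega, by omega,
        by omega, by omega, by omega⟩
    · exact ⟨1, -1, by omega, normeq 1 (-1) (by omega) (by omega), by omega, by omega, by omega,
        by omega, by omega, by omega⟩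
  · -- `n = u₀ + u₁`
    by_cases hc : 1 ≤ u 0
    · exact ⟨1, 0, by omega, normeq 1 0 (by omega) (by omega), by omega, by omega, by omega,
        by omega, by omega, by omega⟩
    · exact ⟨0, 1, by omega, normeq 0 1 (by omega) (by omega), by omega, by omega, by omega,
        by omega, by omega, by omega⟩
  · -- `n = -(u₀ + u₁)`
    by_cases hc : u 0 ≤ -1
    · exact ⟨-1, 0, by omega, normeq (-1) 0 (by omega) (by omega), by omega, by omega, by omega,
        by omega, by omega, by omega⟩
    · exact ⟨0, -1, by omega, normeq 0 (-1) (by omega) (by omega), by omega, by omega, by omega,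
        by omega, by omega, by omega⟩

/-! ### Connectedness -/

/-- **Hexagonally convex regions are connected**: any two sites of `hexConvex c` are joined by a
`𝕋`-path inside it (step towards the target with `exists_step_toward`; each constraint is preserved
since `ℓ(a + e) ≤ max (ℓ a) (ℓ b)`; induction on the graph distance). [folklore] -/
theorem pathIn_hexConvex (c : Fin 6 → ℤ) {a b : Site 2} (ha : a ∈ hexConvex c) (hb : b ∈ hexConvex c) :
    PathIn triGraph (hexConvex c) a b := by
  -- induction on `|b - a|`
  suffices H : ∀ k : ℕ, ∀ a : Site 2, a ∈ hexConvex c → triNorm (b - a) ≤ k →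
      PathIn triGraph (hexConvex c) a b from
    H (triNorm (b - a)).toNat a ha (Int.self_le_toNat _)
  intro k
  induction k with
  | zero =>
    intro a ha hk
    have hab : b = a := by
      have h := triNorm_le_iff_lin.1 hk
      simp only [Pi.sub_apply] at h
      ext i; fin_cases i <;> simp <;> omega
    rw [hab]; exact PathIn.refl ha
  | succ k ih =>
    intro a ha hk
    by_cases hab : b - a = 0
    · have : b = a := sub_eq_zero.1 hab
      rw [this]; exact PathIn.refl ha
    · obtain ⟨s, t, hst, hnorm, c0, c1, c2, c3, c4, c5⟩ := exists_step_toward hab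
      simp only [Pi.sub_apply] at hnorm c0 c1 c2 c3 c4 c5
      set a' : Site 2 := ![a 0 + s, a 1 + t] with ha'
      have ha'0 : a' 0 = a 0 + s := by simp [ha']
      have ha'1 : a' 1 = a 1 + t := by simp [ha']
      obtain ⟨g0, g1, g2, g3, g4, g5⟩ := ha
      obtain ⟨b0, b1, b2, b3, b4, b5⟩ := hb
      -- the step has coordinates in `{-1, 0, 1}`
      have hs : -1 ≤ s ∧ s ≤ 1 := by omega
      have ht : -1 ≤ t ∧ t ≤ 1 := by omega
      have hs' : -1 ≤ s + t ∧ s + t ≤ 1 := by omega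
      have m0 : a 0 + s ≤ c 0 := by rcases c0 with h | h <;> omega
      have m1 : -(a 0 + s) ≤ c 1 := by rcases c1 with h | h <;> omega
      have m2 : a 1 + t ≤ c 2 := by rcases c2 with h | h <;> omega
      have m3 : -(a 1 + t) ≤ c 3 := by rcases c3 with h | h <;> omega
      have m4 : a 0 + s + (a 1 + t) ≤ c 4 := by rcases c4 with h | h <;> omega
      have m5 : -(a 0 + s + (a 1 + t)) ≤ c 5 := by rcases c5 with h | h <;> omega
      clear c0 c1 c2 c3 c4 c5
      have ha'mem : a' ∈ hexConvex c := by
        rw [mem_hexConvex, ha'0, ha'1]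
        exact ⟨m0, m1, m2, m3, m4, m5⟩
      have hadj : triGraph.Adj a a' := by
        rw [triGraph_adj_iff_coord, ha'0, ha'1]
        rcases hst with ⟨h1, h2⟩ | ⟨h1, h2⟩ | ⟨h1, h2⟩ | ⟨h1, h2⟩ | ⟨h1, h2⟩ | ⟨h1, h2⟩ <;>
          subst h1 h2 <;> simp
      have hdiff : b - a' = ![b 0 - a 0 - s, b 1 - a 1 - t] := by
        ext i; fin_cases i
        · show b 0 - a' 0 = b 0 - a 0 - s
          rw [ha'0]; ring
        · show b 1 - a' 1 = b 1 - a 1 - t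
          rw [ha'1]; ring
      have hnorm' : triNorm (b - a') = triNorm (b - a) - 1 := by
        rw [hdiff, ← hnorm]
      have hk' : triNorm (b - a') ≤ k := by push_cast at hk; omega
      exact (PathIn.of_adj (show a ∈ hexConvex c from ⟨g0, g1, g2, g3, g4, g5⟩) ha'mem hadj).trans
        (ih a' ha'mem hk')

/-- **Connecting two sites inside a set that contains a hexagonally convex region through them.** [folklore] -/
theorem pathIn_of_hexConvex_subset {A : Set (Site 2)} (c : Fin 6 → ℤ) (hA : hexConvex c ⊆ A)
    {a b : Site 2} (ha : a ∈ hexConvex c) (hb : b ∈ hexConvex c) : PathIn triGraph A a b :=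
  (pathIn_hexConvex c ha hb).mono hA

/-- The hexagon `Λ_D(v) = {|· - v|_𝕋 ≤ D}` as a hexagonally convex region. [folklore] -/
theorem triNorm_sub_le_iff_mem_hexConvex {v z : Site 2} {D : ℤ} :
    triNorm (z - v) ≤ D ↔
      z ∈ hexConvex ![D + v 0, D - v 0, D + v 1, D - v 1, D + (v 0 + v 1), D - (v 0 + v 1)] := by
  rw [triNorm_le_iff_lin, mem_hexConvex]
  simp only [Pi.sub_apply, Matrix.cons_val_zero, Matrix.cons_val_one, Matrix.cons_val]
  omega

end Literature.Probability.Percolation
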